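import Summits.HodgeConjecture.HodgeConjecture.Theses.SplitImpliesAll
import Literature.AlgebraicGeometry.HodgeTheory.WeilSurfaceSquareModel
import Literature.AlgebraicGeometry.Motives.AbelianVarietyProjectiveChart
import HarnessLib

/-!
# Route `SplitImpliesAll` — CARRIER WITNESSES for the data binders of its items (vhodge seat P3, g16)

SUPPORT file (bookkeeping, no mathematics beyond the tree): the tribunal kernel's t-carrier probe reported the data binders
`A : AbelianVariety ℂ` and `e, e₀ : ProjectiveEmbedding A.X` of the items `SplitSixfoldCells` / `NonsplitSixfoldCells` /
`NonsplitCellsConnected` as `carrier-unverified` (inhabitedness not decided by its instance portfolio). Both carriers are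
INHABITED, by name, from Literature theorems: an explicit complex elliptic curve (`WeilSquare.curveAV`) and the projective
embedding of every abelian variety (`AbelianVariety.isSmoothProjective_holds`). The family binders `f : 𝒳 ⟶ S`, `s` of the
variational item are context-dependent (not inhabited for ALL earlier binders) and are deliberately not addressed.
Nothing here proves a case of the Hodge conjecture. [folklore] [cite: MumfordAV1970, §6 Application 1 (p. 62)]
-/

set_option linter.dupNamespace false

open Literature.AlgebraicGeometry Literature.AlgebraicGeometry.Motives Literature.AlgebraicGeometry.HodgeTheory

namespace Summit.HodgeConjecture.HodgeConjecture.Theorems.SplitImpliesAllCarriers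

/-- **`AbelianVariety ℂ` is inhabited**: the elliptic curve `E_i = ℂ/(ℤ + iℤ)` as a complex abelian variety.
[cite: SilvermanAEC2009, III.3.6] -/
theorem nonempty_abelianVariety : Nonempty (AbelianVariety ℂ) :=
  ⟨WeilSquare.curveAV Complex.I (by simp)⟩

/-- **Every complex abelian variety has a projective embedding** (binder `e : ProjectiveEmbedding A.X` of the cell items).
[cite: MumfordAV1970, §6 Application 1 (p. 62)] -/
theorem nonempty_projectiveEmbedding (A : AbelianVariety ℂ) : Nonempty (ProjectiveEmbedding A.X) :=
  ⟨(AbelianVariety.isSmoothProjective_holds (A := A)).isProjectiveOver.projectiveEmbedding⟩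

/-- A smooth projective `ℂ`-scheme has a projective embedding (binder `e` after the `IsSmoothProjective` hypothesis). [folklore] -/
theorem nonempty_projectiveEmbedding_of_isSmoothProjective {n : ℕ} {X : SchemeOver ℂ}
    (hX : IsSmoothProjective n X) : Nonempty (ProjectiveEmbedding X) :=
  ⟨hX.isProjectiveOver.projectiveEmbedding⟩

end Summit.HodgeConjecture.HodgeConjecture.Theorems.SplitImpliesAllCarriers
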